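import Mathlib.Topology.Order.IntermediateValue
import Mathlib.Topology.Algebra.Polynomial
import Mathlib.Analysis.SpecialFunctions.Pow.Real

/-!
# The ring `ℤ[τ]`, `τ³ = τ² + τ + 1` (tribonacci constant), with its embedding into `ℝ`

Framing: lottery ticket; floor = certified bounds/negative ranges. Venture `PackingBounds` (cell
`pub-packcert`, seat `pub-packcert-recog`). A small computable model of the order `ℤ[τ]` of the cubic
field `ℚ(τ)`, `τ = 1.8392867…` the real root of `X³ - X² - X - 1` (the *tribonacci constant*): triples
`⟨a, b, c⟩ ↔ a + bτ + cτ²` with the multiplication reduced by `τ³ = τ² + τ + 1`, `τ⁴ = 2τ² + 2τ + 1`,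
a `CommRing` instance with decidable equality (so that the distance-distribution checks of
`Configurations/ListConfig.lean` run by `decide`), the real root `tau` (from the intermediate value
theorem, with the enclosure `1.839286 < tau < 1.839287`) and the ring homomorphism
`toReal : TribInt →+* ℝ`, `⟨a, b, c⟩ ↦ a + b·tau + c·tau²`.
Used by `Configurations/SnubCube.lean` (the `24` vertices of the snub cube, Tammes `N = 24`, have
coordinates in `ℤ[τ]`). The construction mirrors Mathlib's `Zsqrtd`.
-/

namespace Summit.Ventures.PackingBounds.Config

/-- Elements `a + bτ + cτ²` of `ℤ[τ]`, `τ³ = τ² + τ + 1`. -/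
@[ext]
structure TribInt where
  /-- coefficient of `1` -/
  c0 : ℤ
  /-- coefficient of `τ` -/
  c1 : ℤ
  /-- coefficient of `τ²` -/
  c2 : ℤ
  deriving DecidableEq, Repr

namespace TribInt

/-- The image of an integer. -/
def ofInt (n : ℤ) : TribInt := ⟨n, 0, 0⟩

/-- Zero. -/
instance : Zero TribInt := ⟨ofInt 0⟩

/-- One. -/
instance : One TribInt := ⟨ofInt 1⟩

/-- The generator `τ`. -/
def τ : TribInt := ⟨0, 1, 0⟩

/-- Default element `0`. -/
instance : Inhabited TribInt := ⟨0⟩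

/-- Componentwise addition. -/
instance : Add TribInt := ⟨fun x y => ⟨x.c0 + y.c0, x.c1 + y.c1, x.c2 + y.c2⟩⟩

/-- Componentwise negation. -/
instance : Neg TribInt := ⟨fun x => ⟨-x.c0, -x.c1, -x.c2⟩⟩

/-- Multiplication, reduced by `τ³ = τ² + τ + 1` and `τ⁴ = 2τ² + 2τ + 1`. -/
instance : Mul TribInt := ⟨fun x y =>
  ⟨x.c0 * y.c0 + (x.c1 * y.c2 + x.c2 * y.c1) + x.c2 * y.c2,
   x.c0 * y.c1 + x.c1 * y.c0 + (x.c1 * y.c2 + x.c2 * y.c1) + 2 * (x.c2 * y.c2),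
   x.c0 * y.c2 + x.c1 * y.c1 + x.c2 * y.c0 + (x.c1 * y.c2 + x.c2 * y.c1) + 2 * (x.c2 * y.c2)⟩⟩

/-- Component `c0` of `0`. -/
@[simp] theorem zero_c0 : (0 : TribInt).c0 = 0 := rfl
/-- Component `c1` of `0`. -/
@[simp] theorem zero_c1 : (0 : TribInt).c1 = 0 := rfl
/-- Component `c2` of `0`. -/
@[simp] theorem zero_c2 : (0 : TribInt).c2 = 0 := rfl
/-- Component `c0` of `1`. -/
@[simp] theorem one_c0 : (1 : TribInt).c0 = 1 := rfl
/-- Component `c1` of `1`. -/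
@[simp] theorem one_c1 : (1 : TribInt).c1 = 0 := rfl
/-- Component `c2` of `1`. -/
@[simp] theorem one_c2 : (1 : TribInt).c2 = 0 := rfl
/-- Component `c0` of a sum. -/
@[simp] theorem add_c0 (x y : TribInt) : (x + y).c0 = x.c0 + y.c0 := rfl
/-- Component `c1` of a sum. -/
@[simp] theorem add_c1 (x y : TribInt) : (x + y).c1 = x.c1 + y.c1 := rfl
/-- Component `c2` of a sum. -/
@[simp] theorem add_c2 (x y : TribInt) : (x + y).c2 = x.c2 + y.c2 := rfl
/-- Component `c0` of a negation. -/
@[simp] theorem neg_c0 (x : TribInt) : (-x).c0 = -x.c0 := rfl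
/-- Component `c1` of a negation. -/
@[simp] theorem neg_c1 (x : TribInt) : (-x).c1 = -x.c1 := rfl
/-- Component `c2` of a negation. -/
@[simp] theorem neg_c2 (x : TribInt) : (-x).c2 = -x.c2 := rfl
/-- Component `c0` of a product. -/
@[simp] theorem mul_c0 (x y : TribInt) :
    (x * y).c0 = x.c0 * y.c0 + (x.c1 * y.c2 + x.c2 * y.c1) + x.c2 * y.c2 := rfl
/-- Component `c1` of a product. -/
@[simp] theorem mul_c1 (x y : TribInt) :
    (x * y).c1 = x.c0 * y.c1 + x.c1 * y.c0 + (x.c1 * y.c2 + x.c2 * y.c1) + 2 * (x.c2 * y.c2) := rfl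
/-- Component `c2` of a product. -/
@[simp] theorem mul_c2 (x y : TribInt) : (x * y).c2 =
    x.c0 * y.c2 + x.c1 * y.c1 + x.c2 * y.c0 + (x.c1 * y.c2 + x.c2 * y.c1) + 2 * (x.c2 * y.c2) := rfl

/-- Additive group structure (componentwise). -/
instance addCommGroup : AddCommGroup TribInt := by
  refine
  { sub := fun a b => a + -b
    nsmul := @nsmulRec TribInt ⟨0⟩ ⟨(· + ·)⟩
    zsmul := @zsmulRec TribInt ⟨0⟩ ⟨(· + ·)⟩ ⟨Neg.neg⟩ (@nsmulRec TribInt ⟨0⟩ ⟨(· + ·)⟩)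
    add_assoc := ?_
    zero_add := ?_
    add_zero := ?_
    neg_add_cancel := ?_
    add_comm := ?_ } <;>
  intros <;>
  ext <;>
  simp [add_comm, add_left_comm]

/-- Component `c0` of a difference. -/
@[simp] theorem sub_c0 (x y : TribInt) : (x - y).c0 = x.c0 - y.c0 := by
  change (x + -y).c0 = _; simp [sub_eq_add_neg]
/-- Component `c1` of a difference. -/
@[simp] theorem sub_c1 (x y : TribInt) : (x - y).c1 = x.c1 - y.c1 := by
  change (x + -y).c1 = _; simp [sub_eq_add_neg]
/-- Component `c2` of a difference. -/
@[simp] theorem sub_c2 (x y : TribInt) : (x - y).c2 = x.c2 - y.c2 := by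
  change (x + -y).c2 = _; simp [sub_eq_add_neg]

/-- Casts of naturals and integers. -/
instance addGroupWithOne : AddGroupWithOne TribInt :=
  { TribInt.addCommGroup with
    natCast := fun n => ofInt n
    intCast := ofInt }

/-- `ℤ[τ]` is a commutative ring. -/
instance commRing : CommRing TribInt := by
  refine
  { TribInt.addGroupWithOne with
    npow := @npowRec TribInt ⟨1⟩ ⟨(· * ·)⟩,
    add_comm := ?_
    left_distrib := ?_
    right_distrib := ?_
    zero_mul := ?_
    mul_zero := ?_
    mul_assoc := ?_
    one_mul := ?_
    mul_one := ?_
    mul_comm := ?_ } <;>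
  intros <;>
  ext <;>
  simp <;>
  ring

/-- `τ · τ · τ = τ · τ + τ + 1` in `ℤ[τ]` (sanity check of the multiplication table). -/
theorem τ_cubic : τ * τ * τ = τ * τ + τ + 1 := by decide

/-! ### The real root and the embedding -/

/-- The cubic `x³ - x² - x - 1` has a root in `(1.839286, 1.839287)` (intermediate value theorem). -/
theorem exists_root : ∃ t : ℝ, t ∈ Set.Ioo (1.839286 : ℝ) 1.839287 ∧ t ^ 3 - t ^ 2 - t - 1 = 0 := by
  have hc : ContinuousOn (fun x : ℝ => x ^ 3 - x ^ 2 - x - 1) (Set.Icc (1.839286 : ℝ) 1.839287) := by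
    fun_prop
  have h := intermediate_value_Ioo (by norm_num : (1.839286 : ℝ) ≤ 1.839287) hc
  have h0 : (0 : ℝ) ∈ Set.Ioo ((fun x : ℝ => x ^ 3 - x ^ 2 - x - 1) 1.839286)
      ((fun x : ℝ => x ^ 3 - x ^ 2 - x - 1) 1.839287) := by
    constructor <;> norm_num
  obtain ⟨t, ht, hft⟩ := h h0
  exact ⟨t, ht, hft⟩

/-- `tau = 1.8392867…`, the real root of `x³ = x² + x + 1` (tribonacci constant). -/
noncomputable def tau : ℝ := Classical.choose exists_root

/-- The defining relation `tau³ = tau² + tau + 1`. -/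
theorem tau_cubic : tau ^ 3 = tau ^ 2 + tau + 1 := by
  have h := (Classical.choose_spec exists_root).2
  change tau ^ 3 - tau ^ 2 - tau - 1 = 0 at h
  linarith

/-- Lower enclosure `1.839286 < tau`. -/
theorem tau_gt : (1.839286 : ℝ) < tau := (Classical.choose_spec exists_root).1.1

/-- Upper enclosure `tau < 1.839287`. -/
theorem tau_lt : tau < (1.839287 : ℝ) := (Classical.choose_spec exists_root).1.2

/-- `tau⁴ = 2 tau² + 2 tau + 1`. -/
theorem tau_pow_four : tau ^ 4 = 2 * tau ^ 2 + 2 * tau + 1 := by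
  have h := tau_cubic
  linear_combination (tau + 1) * h

/-- The embedding `ℤ[τ] →+* ℝ`, `⟨a, b, c⟩ ↦ a + b·tau + c·tau²`. -/
noncomputable def toReal : TribInt →+* ℝ where
  toFun x := (x.c0 : ℝ) + x.c1 * tau + x.c2 * tau ^ 2
  map_one' := by simp
  map_mul' := by
    intro x y
    simp only [mul_c0, mul_c1, mul_c2]
    push_cast
    have h := tau_cubic
    linear_combination (-(↑x.c1 * ↑y.c2 + ↑x.c2 * ↑y.c1 + ↑x.c2 * ↑y.c2 * (tau + 1))) * h
  map_zero' := by simp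
  map_add' := by
    intro x y
    simp only [add_c0, add_c1, add_c2]
    push_cast
    ring

/-- Evaluation of the embedding. -/
@[simp] theorem toReal_apply (x : TribInt) :
    toReal x = (x.c0 : ℝ) + x.c1 * tau + x.c2 * tau ^ 2 := rfl

/-- The embedding sends `τ` to `tau`. -/
theorem toReal_τ : toReal τ = tau := by simp [τ]

end TribInt

end Summit.Ventures.PackingBounds.Config
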